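import Literature.Barriers.CriticalPhenomena.KozmaNachmiasLemma23B2
import HarnessLib

/-!
# Kozma–Nachmias 2011, Chapter 4: typical clusters (4.1), `s`-bad and `K`-irregular boundary
# vertices (Definition 4.1), `X_j^{K-irr}`, and the regularity Theorem 4 as a named fact

Barrier catalogue `Literature/Barriers/CriticalPhenomena/` (D-0021), programme for the named fact
`KozmaNachmias2011_thm2` (Theorem 2 of Kozma–Nachmias 2011, the residual input of the one-arm
upper bound `KozmaNachmias2011_oneArmUpper`, see `KozmaNachmiasLemma23.lean`). Theorem 2 is proved
in Chapter 5 of the source from the **regularity theorem** (Theorem 4, Chapter 4) and the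
second-moment Lemmas 5.1–5.2. This file vendors the OBJECTS of §4.1 with real bodies and Theorem 4
as a named fact, so that the assembly of Chapter 5 (`KozmaNachmiasTheorem2.lean`) can be proved
against them:

* `localClusterCard d s x ω = |C(x) ∩ (x + Q_s)|` and the "typical cluster" event
  `typicalEvent d s x = T_s(x) = {|C(x) ∩ (x + Q_s)| < s⁴ log⁷ s}` — (4.1), p. 388;
* the conditioning "`| C(x; Q_j)`" of Definition 4.1 (p. 389: "we condition on all open edges
  between two vertices of the cluster `C(x; Q_j)` as well as on all closed edges with both vertices
  in `Q_j` and at least one vertex in `C(x; Q_j)`. In short, we condition on all information needed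
  to calculate `C(x; Q_j)` precisely"): `clusterIn S x ω = C(x; S)`, the conditioned pairs
  `clusterPairs S (clusterIn S x ω)` (the pairs of `S` touching the cluster, the tree's
  `Literature.Probability.Percolation.DCT16.clusterPairs`), the atom `clusterAtom S x ω` of `ω`
  (configurations agreeing with `ω` on those pairs) and the elementary conditional probability
  `condProbCluster p S x T ω = P_p(T ∩ atom)/P_p(atom)`; PROVED: the atom determines the cluster
  (`clusterIn_eq_of_mem_clusterAtom`, the exploration property the source invokes on p. 389 and in
  (5.3)) and the atoms partition the configurations (`clusterAtom_eq_of_mem_clusterAtom`);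
* Definition 4.1: `IsSBad p j s x ω` ("`x` is `s`-bad": `P(T_s(x) | C(x;Q_j)) ≤ 1 - exp(-log² s)`,
  (4.2)) and `IsKIrregular p j K x ω` ("`K`-irregular": `s`-bad for some `s ≥ K`); the counts
  `irrBoundaryConnCount = X_j^{K-irr}` (p. 390) and `regBoundaryConnCount = X_j^{K-reg}`
  (p. 398, `X_j^{K-reg} = X_j - X_j^{K-irr}`), with `boundaryConnCount_eq_irr_add_reg` and their
  measurability (each is determined by the pairs of `Q_j`, `determinedBy_isKIrregular`);
* NAMED FACT `KozmaNachmias2011_thm4` — **Theorem 4** (p. 390): "There exist constants `C > c > 0`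
  such that for any `K` sufficiently large and any `j` and `M` we have
  `P(X_j ≥ M and X_j^{K-irr} ≥ X_j/2) ≤ C j^d exp(-c log² M)`", under the standing hypotheses of
  the conditional Thm. 1 (§1.1: `d > 6` and the two-point estimate (1.2), here
  `TwoPointBoundedRatio d`; its proof, Thm. 5 with Lemmas 4.3–4.6, uses (1.1) and the diagrammatic
  bounds of Aizenman 1997 through Lemma 4.4), at `p = p_c`, for `j ≥ 1` (for `j = 0` the printed
  right-hand side vanishes while `X_0 = 1`; the source only uses `j` large) and `M ∈ ℕ`.

Conventions. `log` is the natural logarithm (the source does not fix the base; all uses are up to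
the unspecified constants `c, C`); `s, K, M ∈ ℕ` ("positive integers `s` and `K`", Def. 4.1);
`x + Q_s = {x + z : z ∈ Q_s}`; all probabilities are `P_{p_c}` on the nearest-neighbour lattice
`ℤ^d` (`bondPercolation (zdGraph d) (criticalProbI d)`), the conditional probability being taken
with respect to the same `p` that is passed to `IsSBad`. The conditioned pairs include the pairs of
`Q_j` touching the cluster that are not lattice edges; these are almost surely closed, so
conditioning on them as well does not change the conditional probabilities (it makes the
exploration property `clusterIn_eq_of_mem_clusterAtom` hold for every configuration, not only
almost surely).

## References

* G. Kozma, A. Nachmias, *Arm exponents in high dimensional percolation*, J. Amer. Math. Soc. 24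
  (2011) 375–409: (4.1) p. 388; Definition 4.1 and the meaning of "`| C(x;Q_j)`", p. 389;
  `X_j^{K-irr}` and Theorem 4, p. 390; `X_j^{K-reg} = X_j - X_j^{K-irr}`, p. 398; §1.1 (standing
  hypotheses of the conditional Thm. 1).
* H. Duminil-Copin, V. Tassion, Enseign. Math. 62 (2016) 199–206, §2.1 (conditioning on the
  cluster inside a finite set: the pairs touching the cluster).
-/

noncomputable section

namespace Literature.Barriers.CriticalPhenomena

open _root_.MeasureTheory Finset Literature.Probability.LatticeModels Literature.Probability.Percolation
  Literature.Probability.Percolation.DCT16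
open scoped Literature.Probability.LatticeModels Literature.Probability.Percolation

variable {d : ℕ}

/-! ### (4.1): the typical-cluster event `T_s(x)` -/

section Typical

open scoped Classical in
/-- **`|C(x) ∩ (x + Q_s)|`** (Kozma–Nachmias 2011, (4.1)): the number of vertices of the translated
cube `x + Q_s` joined to `x` by an open path (anywhere in `ℤ^d`), counted as the number of
`z ∈ Q_s` with `x ↔ x + z`. [cite: KozmaNachmias2011, (4.1)] -/
def localClusterCard (d s : ℕ) (x : Site d) (ω : BondConfig (Site d)) : ℕ :=
  #((box d s).filter fun z => ω ∈ openConn x (x + z))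

/-- `|C(x) ∩ (x + Q_s)| ≤ |Q_s|`. [folklore] -/
theorem localClusterCard_le_card_box (s : ℕ) (x : Site d) (ω : BondConfig (Site d)) :
    localClusterCard d s x ω ≤ #(box d s) := by
  classical
  unfold localClusterCard
  convert Finset.card_filter_le (box d s) _

/-- **`T_s(x)`** (Kozma–Nachmias 2011, (4.1), "the event that the cluster is typical"):
`T_s(x) = {|C(x) ∩ (x + Q_s)| < s⁴ log⁷ s}` (natural logarithm).
[cite: KozmaNachmias2011, (4.1)] -/
def typicalEvent (d s : ℕ) (x : Site d) : Set (BondConfig (Site d)) :=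
  {ω | (localClusterCard d s x ω : ℝ) < (s : ℝ) ^ 4 * Real.log s ^ 7}

/-- `|C(x) ∩ (x + Q_s)|` is measurable. [folklore] -/
theorem measurable_localClusterCard (d s : ℕ) (x : Site d) :
    Measurable fun ω : BondConfig (Site d) => (localClusterCard d s x ω : ℝ) := by
  unfold localClusterCard
  convert measurable_card_filter_mem (box d s)
    (E := fun z => (openConn x (x + z) : Set (BondConfig (Site d))))
    (fun z _ => measurableSet_openConn_holds x (x + z)) using 1

/-- `T_s(x)` is measurable. [folklore] -/
theorem measurableSet_typicalEvent (d s : ℕ) (x : Site d) : MeasurableSet (typicalEvent d s x) :=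
  measurableSet_lt (measurable_localClusterCard d s x) measurable_const

end Typical

/-! ### Conditioning on `C(x; S)`: the cluster, the conditioned pairs, the atom -/

section Conditioning

open scoped Classical in
/-- **`C(x; S)`** (Kozma–Nachmias 2011, §1.6: "`C(x; A) = {y : x ↔ y in A}`", the vertices joined
to `x` by an open path inside `S`), as a finset (empty unless `x ∈ S`).
[cite: KozmaNachmias2011, §1.6] -/
def clusterIn (S : Finset (Site d)) (x : Site d) (ω : BondConfig (Site d)) : Finset (Site d) :=
  S.filter fun y => ω ∈ openConnIn (↑S : Set (Site d)) x y

/-- Membership in `C(x; S)`. [cite: KozmaNachmias2011, §1.6] -/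
theorem mem_clusterIn {S : Finset (Site d)} {x y : Site d} {ω : BondConfig (Site d)} :
    y ∈ clusterIn S x ω ↔ ω ∈ openConnIn (↑S : Set (Site d)) x y := by
  classical
  simp only [clusterIn, Finset.mem_filter, and_iff_right_iff_imp]
  exact fun h => (pathIn_of_mem_openConnIn h).right_mem

/-- Membership in `C(x; S)` in terms of open paths inside `S`. [folklore] -/
theorem mem_clusterIn_iff_pathIn {S : Finset (Site d)} {x y : Site d} {ω : BondConfig (Site d)} :
    y ∈ clusterIn S x ω ↔ PathIn (openGraph ω) (↑S : Set (Site d)) x y := by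
  rw [mem_clusterIn, mem_openConnIn_iff_pathIn]

/-- `C(x; S) ⊆ S`. [folklore] -/
theorem clusterIn_subset (S : Finset (Site d)) (x : Site d) (ω : BondConfig (Site d)) :
    clusterIn S x ω ⊆ S := by
  classical
  exact Finset.filter_subset _ _

/-- `x ∈ C(x; S)` for `x ∈ S`. [folklore] -/
theorem self_mem_clusterIn {S : Finset (Site d)} {x : Site d} (hx : x ∈ S) (ω : BondConfig (Site d)) :
    x ∈ clusterIn S x ω :=
  mem_clusterIn_iff_pathIn.2 (PathIn.refl (Finset.mem_coe.2 hx))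

/-- **The atom of `ω` under the conditioning "`| C(x; S)`"** (Kozma–Nachmias 2011, p. 389: "we
condition on all open edges between two vertices of the cluster `C(x; Q_j)` as well as on all closed
edges with both vertices in `Q_j` and at least one vertex in `C(x; Q_j)`"): the configurations that
agree with `ω` on every pair of `S` with at least one member in `C(x; S)(ω)`
(`clusterPairs S (clusterIn S x ω)`; pairs that are not lattice edges are almost surely closed, so
including them is immaterial for the conditional probabilities).
[cite: KozmaNachmias2011, Definition 4.1 (p. 389)] -/
def clusterAtom (S : Finset (Site d)) (x : Site d) (ω : BondConfig (Site d)) :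
    Set (BondConfig (Site d)) :=
  localCylinder (↑(clusterPairs S (clusterIn S x ω)) : Set (Sym2 (Site d))) ω

/-- `ω` lies in its own atom. [folklore] -/
theorem mem_clusterAtom_self (S : Finset (Site d)) (x : Site d) (ω : BondConfig (Site d)) :
    ω ∈ clusterAtom S x ω :=
  mem_localCylinder_self _ _

/-- Membership in the atom: agreement on the conditioned pairs. [folklore] -/
theorem mem_clusterAtom_iff {S : Finset (Site d)} {x : Site d} {ω ω' : BondConfig (Site d)} :
    ω' ∈ clusterAtom S x ω ↔ ∀ e ∈ clusterPairs S (clusterIn S x ω), e ∈ ω' ↔ e ∈ ω := by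
  simp only [clusterAtom, localCylinder, Set.mem_setOf_eq, Finset.mem_coe]

/-- Atoms are measurable. [folklore] -/
theorem measurableSet_clusterAtom (S : Finset (Site d)) (x : Site d) (ω : BondConfig (Site d)) :
    MeasurableSet (clusterAtom S x ω) :=
  measurableSet_localCylinder (Finset.countable_toSet _) _

/-- **The atom determines the cluster** (the exploration property behind Definition 4.1 and (5.3):
"no information from the rest of the configuration is needed"): if `ω'` agrees with `ω` on the
pairs of `S` touching `C(x; S)(ω)`, then `C(x; S)(ω') = C(x; S)(ω)` — an open path of `ω'` from `x`
inside `S` never leaves the cluster (its exit pair would touch the cluster and be closed in `ω`),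
and the open paths of `ω` inside the cluster are open in `ω'`.
[cite: KozmaNachmias2011, Definition 4.1 (p. 389) and (5.3)] -/
theorem clusterIn_eq_of_mem_clusterAtom {S : Finset (Site d)} {x : Site d}
    {ω ω' : BondConfig (Site d)} (h : ω' ∈ clusterAtom S x ω) :
    clusterIn S x ω' = clusterIn S x ω := by
  rw [mem_clusterAtom_iff] at h
  set C := clusterIn S x ω with hC
  have hadj : ∀ a b : Site d, a ∈ S → b ∈ S → a ∈ C →
      ((openGraph ω).Adj a b ↔ (openGraph ω').Adj a b) := by
    intro a b ha hb haC
    have key := h _ (mk_mem_clusterPairs ha hb (Or.inl haC))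
    rw [openGraph_adj, openGraph_adj, key]
  ext z
  constructor
  · -- a path of `ω'` inside `S` from `x` stays in `C`
    intro hz
    rw [mem_clusterIn_iff_pathIn] at hz
    refine pathIn_induction (fun w => w ∈ C) hz ?_ ?_
    · exact self_mem_clusterIn (Finset.mem_coe.1 hz.left_mem) ω
    · intro a b haS hbS haC hab
      have ha := mem_clusterIn_iff_pathIn.1 haC
      exact mem_clusterIn_iff_pathIn.2 (ha.tail ((hadj a b haS hbS haC).2 hab) hbS)
  · -- a path of `ω` inside `C(x; S)(ω) = C` is a path of `ω'`
    intro hz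
    rw [mem_clusterIn_iff_pathIn] at hz ⊢
    have hz' := pathIn_restrict_cluster hz
    refine (pathIn_congrGraph (G' := openGraph ω') ?_ hz').mono Set.inter_subset_left
    intro a b ha hb hab
    exact (hadj a b ha.1 hb.1 (mem_clusterIn_iff_pathIn.2 ha.2)).1 hab

/-- **The atoms partition the configurations**: `ω' ∈ atom(ω)` implies `atom(ω') = atom(ω)`.
[cite: KozmaNachmias2011, Definition 4.1 (p. 389)] -/
theorem clusterAtom_eq_of_mem_clusterAtom {S : Finset (Site d)} {x : Site d}
    {ω ω' : BondConfig (Site d)} (h : ω' ∈ clusterAtom S x ω) :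
    clusterAtom S x ω' = clusterAtom S x ω := by
  have hC := clusterIn_eq_of_mem_clusterAtom h
  rw [mem_clusterAtom_iff] at h
  ext ω''
  rw [mem_clusterAtom_iff, mem_clusterAtom_iff, hC]
  exact forall₂_congr fun e he => by rw [h e he]

/-- **`P_p(T | C(x; S))(ω)`** (Kozma–Nachmias 2011, Definition 4.1, the conditional probability
given "all information needed to calculate `C(x; Q_j)` precisely"): the elementary conditional
probability of `T` on the atom of `ω`, `P_p(T ∩ atom(ω))/P_p(atom(ω))` (the atoms have positive
probability for `0 < p < 1`, being cylinders over finitely many pairs; the quotient is `0` by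
convention when the denominator vanishes). [cite: KozmaNachmias2011, Definition 4.1 (4.2)] -/
def condProbCluster (p : unitInterval) (S : Finset (Site d)) (x : Site d)
    (T : Set (BondConfig (Site d))) (ω : BondConfig (Site d)) : ℝ :=
  (bondPercolation (zdGraph d) p).real (T ∩ clusterAtom S x ω) /
    (bondPercolation (zdGraph d) p).real (clusterAtom S x ω)

/-- `0 ≤ P(T | C(x;S))`. [folklore] -/
theorem condProbCluster_nonneg (p : unitInterval) (S : Finset (Site d)) (x : Site d)
    (T : Set (BondConfig (Site d))) (ω : BondConfig (Site d)) : 0 ≤ condProbCluster p S x T ω :=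
  div_nonneg measureReal_nonneg measureReal_nonneg

/-- `P(T | C(x;S)) ≤ 1`. [folklore] -/
theorem condProbCluster_le_one (p : unitInterval) (S : Finset (Site d)) (x : Site d)
    (T : Set (BondConfig (Site d))) (ω : BondConfig (Site d)) : condProbCluster p S x T ω ≤ 1 :=
  div_le_one_of_le₀ (measureReal_mono Set.inter_subset_right) measureReal_nonneg

/-- Configurations agreeing on the pairs of `S` have the same `C(x; S)`. [folklore] -/
theorem clusterIn_congr {S : Finset (Site d)} {x : Site d} {ω ω' : BondConfig (Site d)}
    (h : ω ∩ ↑S.sym2 = ω' ∩ ↑S.sym2) : clusterIn S x ω = clusterIn S x ω' := by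
  ext y
  rw [mem_clusterIn, mem_clusterIn]
  exact (determinedBy_iff _ _).1
    (determinedBy_openConnIn (↑S : Set (Site d)) x y (K := ↑S.sym2) (by rw [Finset.coe_sym2])) ω ω' h

/-- Configurations agreeing on the pairs of `S` have the same atom. [folklore] -/
theorem clusterAtom_congr {S : Finset (Site d)} {x : Site d} {ω ω' : BondConfig (Site d)}
    (h : ω ∩ ↑S.sym2 = ω' ∩ ↑S.sym2) : clusterAtom S x ω = clusterAtom S x ω' := by
  ext ω''
  rw [mem_clusterAtom_iff, mem_clusterAtom_iff, clusterIn_congr h]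
  refine forall₂_congr fun e he => ?_
  have heS : e ∈ (↑S.sym2 : Set (Sym2 (Site d))) := Finset.mem_coe.2 (Finset.sdiff_subset he)
  have key : e ∈ ω ↔ e ∈ ω' :=
    ⟨fun h1 => (((Set.ext_iff.1 h) e).1 ⟨h1, heS⟩).1, fun h1 => (((Set.ext_iff.1 h) e).2 ⟨h1, heS⟩).1⟩
  rw [key]

/-- Configurations agreeing on the pairs of `S` have the same conditional probabilities given
`C(x; S)`. [folklore] -/
theorem condProbCluster_congr (p : unitInterval) {S : Finset (Site d)} {x : Site d}
    (T : Set (BondConfig (Site d))) {ω ω' : BondConfig (Site d)} (h : ω ∩ ↑S.sym2 = ω' ∩ ↑S.sym2) :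
    condProbCluster p S x T ω = condProbCluster p S x T ω' := by
  rw [condProbCluster, condProbCluster, clusterAtom_congr h]

/-- Conditional probabilities given `C(x;S)` are constant on atoms. [folklore] -/
theorem condProbCluster_eq_of_mem_clusterAtom (p : unitInterval) {S : Finset (Site d)} {x : Site d}
    (T : Set (BondConfig (Site d))) {ω ω' : BondConfig (Site d)} (h : ω' ∈ clusterAtom S x ω) :
    condProbCluster p S x T ω' = condProbCluster p S x T ω := by
  rw [condProbCluster, condProbCluster, clusterAtom_eq_of_mem_clusterAtom h]

end Conditioning

/-! ### Definition 4.1: `s`-bad and `K`-irregular vertices; `X_j^{K-irr}`, `X_j^{K-reg}` -/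

section BadIrregular

/-- **`x` is `s`-bad** (Kozma–Nachmias 2011, Definition 4.1 (i), (4.2)), for `x ∈ ∂Q_j` and a
positive integer `s`: `P_p(T_s(x) | C(x; Q_j)) ≤ 1 - exp(-log² s)`.
[cite: KozmaNachmias2011, Definition 4.1 (i) (4.2)] -/
def IsSBad (p : unitInterval) (j s : ℕ) (x : Site d) (ω : BondConfig (Site d)) : Prop :=
  condProbCluster p (box d j) x (typicalEvent d s x) ω ≤ 1 - Real.exp (-(Real.log s ^ 2))

/-- **`x` is `K`-irregular** (Kozma–Nachmias 2011, Definition 4.1 (ii)): `x` is `s`-bad for some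
`s ≥ K`; "otherwise we say that `x` is `K`-regular" (`¬ IsKIrregular`).
[cite: KozmaNachmias2011, Definition 4.1 (ii)] -/
def IsKIrregular (p : unitInterval) (j K : ℕ) (x : Site d) (ω : BondConfig (Site d)) : Prop :=
  ∃ s : ℕ, K ≤ s ∧ IsSBad p j s x ω

/-- `s`-badness only depends on the pairs of `Q_j`. [folklore] -/
theorem isSBad_congr (p : unitInterval) {j s : ℕ} {x : Site d} {ω ω' : BondConfig (Site d)}
    (h : ω ∩ ↑(box d j).sym2 = ω' ∩ ↑(box d j).sym2) : IsSBad p j s x ω ↔ IsSBad p j s x ω' := by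
  rw [IsSBad, IsSBad, condProbCluster_congr p _ h]

/-- `s`-badness is constant on the atoms of `C(x; Q_j)`. [folklore] -/
theorem isSBad_iff_of_mem_clusterAtom (p : unitInterval) {j s : ℕ} {x : Site d}
    {ω ω' : BondConfig (Site d)} (h : ω' ∈ clusterAtom (box d j) x ω) :
    IsSBad p j s x ω' ↔ IsSBad p j s x ω := by
  rw [IsSBad, IsSBad, condProbCluster_eq_of_mem_clusterAtom p _ h]

/-- `K`-irregularity is constant on the atoms of `C(x; Q_j)` ("`E₁` can be determined by observing
only the edges of `C(x; Q_j)`", p. 400). [cite: KozmaNachmias2011, proof of Lemma 5.3 (p. 400)] -/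
theorem isKIrregular_iff_of_mem_clusterAtom (p : unitInterval) {j K : ℕ} {x : Site d}
    {ω ω' : BondConfig (Site d)} (h : ω' ∈ clusterAtom (box d j) x ω) :
    IsKIrregular p j K x ω' ↔ IsKIrregular p j K x ω :=
  exists_congr fun _ => and_congr_right fun _ => isSBad_iff_of_mem_clusterAtom p h

/-- **`{x is K-irregular}` is determined by the pairs of `Q_j`.** [folklore] -/
theorem determinedBy_isKIrregular (p : unitInterval) (j K : ℕ) (x : Site d) :
    DeterminedBy {ω : BondConfig (Site d) | IsKIrregular p j K x ω} ↑(box d j).sym2 := by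
  rw [determinedBy_iff]
  intro ω ω' h
  simp only [Set.mem_setOf_eq]
  exact exists_congr fun s => and_congr_right fun _ => isSBad_congr p h

/-- `{x is K-irregular}` is measurable. [folklore] -/
theorem measurableSet_isKIrregular (p : unitInterval) (j K : ℕ) (x : Site d) :
    MeasurableSet {ω : BondConfig (Site d) | IsKIrregular p j K x ω} :=
  (determinedBy_isKIrregular p j K x).measurableSet_of_finset

open scoped Classical in
/-- **`X_j^{K-irr}`** (Kozma–Nachmias 2011, p. 390): the number of `x ∈ ∂Q_j` with `0 ↔ x` in `Q_j`
that are `K`-irregular. [cite: KozmaNachmias2011, §4.1 (definition of X_j^{K-irr}, p. 390)] -/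
def irrBoundaryConnCount (d : ℕ) (p : unitInterval) (j K : ℕ) (ω : BondConfig (Site d)) : ℕ :=
  #((sphere d j).filter fun x =>
    ω ∈ openConnIn (↑(box d j) : Set (Site d)) (0 : Site d) x ∧ IsKIrregular p j K x ω)

open scoped Classical in
/-- **`X_j^{K-reg} = X_j - X_j^{K-irr}`** (Kozma–Nachmias 2011, p. 398): the number of `x ∈ ∂Q_j`
with `0 ↔ x` in `Q_j` that are `K`-regular. [cite: KozmaNachmias2011, §5 (definition of X_j^{K-reg}, p. 398)] -/
def regBoundaryConnCount (d : ℕ) (p : unitInterval) (j K : ℕ) (ω : BondConfig (Site d)) : ℕ :=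
  #((sphere d j).filter fun x =>
    ω ∈ openConnIn (↑(box d j) : Set (Site d)) (0 : Site d) x ∧ ¬IsKIrregular p j K x ω)

/-- `X_j = X_j^{K-irr} + X_j^{K-reg}`. [cite: KozmaNachmias2011, §5 (p. 398)] -/
theorem boundaryConnCount_eq_irr_add_reg (p : unitInterval) (j K : ℕ) (ω : BondConfig (Site d)) :
    boundaryConnCount d j ω = irrBoundaryConnCount d p j K ω + regBoundaryConnCount d p j K ω := by
  classical
  unfold boundaryConnCount irrBoundaryConnCount regBoundaryConnCount
  rw [← Finset.filter_filter, ← Finset.filter_filter, Finset.card_filter_add_card_filter_not]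

/-- `X_j^{K-irr} ≤ X_j`. [folklore] -/
theorem irrBoundaryConnCount_le (p : unitInterval) (j K : ℕ) (ω : BondConfig (Site d)) :
    irrBoundaryConnCount d p j K ω ≤ boundaryConnCount d j ω := by
  rw [boundaryConnCount_eq_irr_add_reg p j K]; exact Nat.le_add_right _ _

/-- `X_j^{K-reg} ≤ X_j`. [folklore] -/
theorem regBoundaryConnCount_le (p : unitInterval) (j K : ℕ) (ω : BondConfig (Site d)) :
    regBoundaryConnCount d p j K ω ≤ boundaryConnCount d j ω := by
  rw [boundaryConnCount_eq_irr_add_reg p j K]; exact Nat.le_add_left _ _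

/-- `X_j^{K-irr}` is measurable (as a real-valued function). [folklore] -/
theorem measurable_irrBoundaryConnCount (d : ℕ) (p : unitInterval) (j K : ℕ) :
    Measurable fun ω : BondConfig (Site d) => (irrBoundaryConnCount d p j K ω : ℝ) := by
  unfold irrBoundaryConnCount
  convert measurable_card_filter_mem (sphere d j)
    (E := fun x => openConnIn (↑(box d j) : Set (Site d)) (0 : Site d) x ∩
      {ω : BondConfig (Site d) | IsKIrregular p j K x ω})
    (fun x _ => (measurableSet_openConnIn (box d j) 0 x).inter (measurableSet_isKIrregular p j K x))
    using 1
  funext ω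
  congr 2
  ext x
  simp only [Finset.mem_filter, Set.mem_inter_iff, Set.mem_setOf_eq]

/-- `X_j^{K-reg}` is measurable (as a real-valued function). [folklore] -/
theorem measurable_regBoundaryConnCount (d : ℕ) (p : unitInterval) (j K : ℕ) :
    Measurable fun ω : BondConfig (Site d) => (regBoundaryConnCount d p j K ω : ℝ) := by
  unfold regBoundaryConnCount
  convert measurable_card_filter_mem (sphere d j)
    (E := fun x => openConnIn (↑(box d j) : Set (Site d)) (0 : Site d) x ∩
      {ω : BondConfig (Site d) | IsKIrregular p j K x ω}ᶜ)
    (fun x _ => (measurableSet_openConnIn (box d j) 0 x).inter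
      (measurableSet_isKIrregular p j K x).compl) using 1
  funext ω
  congr 2
  ext x
  simp only [Finset.mem_filter, Set.mem_inter_iff, Set.mem_setOf_eq, Set.mem_compl_iff]

/-- `X_j^{K-reg}` is measurable (as an `ℕ`-valued function). [folklore] -/
theorem measurable_regBoundaryConnCount_nat (d : ℕ) (p : unitInterval) (j K : ℕ) :
    Measurable fun ω : BondConfig (Site d) => regBoundaryConnCount d p j K ω := by
  refine measurable_to_countable' fun n => ?_
  have : (fun ω : BondConfig (Site d) => regBoundaryConnCount d p j K ω) ⁻¹' {n} =
      (fun ω : BondConfig (Site d) => (regBoundaryConnCount d p j K ω : ℝ)) ⁻¹' {(n : ℝ)} := by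
    ext ω; simp
  rw [this]
  exact measurable_regBoundaryConnCount d p j K (measurableSet_singleton _)

end BadIrregular

/-! ### Theorem 4 as a named fact -/

section Theorem4

/-- NAMED FACT — **Kozma–Nachmias 2011, Theorem 4** (p. 390, the regularity theorem): "There exist
constants `C > c > 0` such that for any `K` sufficiently large and any `j` and `M` we have
`P(X_j ≥ M and X_j^{K-irr} ≥ X_j/2) ≤ C j^d exp(-c log² M)`." Here `X_j` is (1.3)
(`boundaryConnCount d j`), `X_j^{K-irr}` is `irrBoundaryConnCount d p_c j K` (Definition 4.1 with
the conditioning on `C(x; Q_j)`), `P = P_{p_c}` on `ℤ^d`; vendored under the standing hypotheses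
of the conditional Thm. 1 (§1.1: (i) `d > 6`, (ii) the two-point estimate, `TwoPointBoundedRatio d`;
the printed proof — Theorem 5 and Claim 4.2, with Lemmas 4.3–4.6 — uses (1.1) and, in Lemma 4.4,
the diagrammatic bounds of Aizenman 1997 which rest on (1.2)), for `j ≥ 1` and `M ∈ ℕ`
(`X_j^{K-irr} ≥ X_j/2` written `X_j ≤ 2 X_j^{K-irr}`). Not proved here; users take
`(h : KozmaNachmias2011_thm4)`. [cite: KozmaNachmias2011, Thm. 4 (p. 390)] -/
def KozmaNachmias2011_thm4 : Prop :=
  ∀ d : ℕ, 6 < d → TwoPointBoundedRatio d →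
    ∃ C c : ℝ, 0 < c ∧ c < C ∧ ∃ K₀ : ℕ, ∀ K : ℕ, K₀ ≤ K → ∀ j : ℕ, 1 ≤ j → ∀ M : ℕ,
      (bondPercolation (zdGraph d) (criticalProbI d)).real
          {ω | M ≤ boundaryConnCount d j ω ∧
            boundaryConnCount d j ω ≤ 2 * irrBoundaryConnCount d (criticalProbI d) j K ω} ≤
        C * (j : ℝ) ^ d * Real.exp (-(c * Real.log M ^ 2))

end Theorem4

end Literature.Barriers.CriticalPhenomena

end
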